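import Mathlib
import HarnessLib
import Literature.MathematicalPhysics.QuantumFieldTheory.GaussianCovarianceComparisonEstimate

/-!
# `‖E_{N(0,S₁)} H − E_{N(0,S₀)} H‖ ≤ C δ ‖H‖_{L^p(N(0,S₀))}` for BANACH-valued `H`
# ([Buc16] Thm 4.5 / [ABKM19] Thm 6.2 and Lemma 8.4 (`ℓ = 1`), crude finite-dimensional core)

`GaussianCovarianceComparisonEstimate.abs_integral_multivariateGaussian_sub_le` compares the
expectations of a REAL functional under two close centred Gaussians.  The renormalisation-group
application ([ABKM19] Lemma 8.4 with `ℓ = 1`: Lipschitz dependence of the integration map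
`R^{(q)}_{k+1}` on `q` in the Taylor norms `‖·‖_{T_φ}`) integrates the multilinear forms
`D^s K(φ + ζ)`, i.e. functionals with values in a Banach space of multilinear maps.  This file
transports the real estimate to Banach-valued `H` by duality (`NormedSpace.norm_le_dual_bound`:
the norm of a vector is controlled by its pairings with norm-one functionals):

* **`norm_integral_multivariateGaussian_sub_le`** — for `S₀, S₁ ≻ 0` with
  `|vᵀ(S₀⁻¹ − S₁⁻¹)v| ≤ δ·vᵀS₀⁻¹v`, Hölder conjugates `p, q`, `0 ≤ δ ≤ 1/(16q)`,
  `H ∈ L^p(N(0,S₀))` Banach-valued and `N(0,S₁)`-integrable: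
  `‖∫ H dN(0,S₁) − ∫ H dN(0,S₀)‖ ≤ gaussCompConst |ι| q · δ · (∫ ‖H‖^p dN(0,S₀))^{1/p}`.

Everything is proved; no named fact.

## References
* S. Buchholz, J. Funct. Anal. 275 (2018), Thm 4.5 [Buchholz2016].
* S. Adams, S. Buchholz, R. Kotecký, S. Müller, arXiv:1910.13564, Theorem 6.2, Lemma 8.4
  [AdamsBuchholzKoteckyMuller2019].
-/

noncomputable section

namespace Literature.MathematicalPhysics.QuantumFieldTheory

open MeasureTheory ProbabilityTheory Matrix
open scoped ENNReal NNReal MatrixOrder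

variable {ι : Type*} [Fintype ι] [DecidableEq ι]

/-- Pairing with a functional commutes with the difference of two expectations (bookkeeping).
[cite: Buchholz2016, Thm 4.5] -/
theorem dual_apply_integral_sub {X : Type*} [MeasurableSpace X] {μ ν : Measure X}
    {F : Type*} [NormedAddCommGroup F] [NormedSpace ℝ F] [CompleteSpace F]
    (f : StrongDual ℝ F) {H : X → F} (hμ : Integrable H μ) (hν : Integrable H ν) :
    f (∫ y, H y ∂μ - ∫ y, H y ∂ν) = ∫ y, f (H y) ∂μ - ∫ y, f (H y) ∂ν := by
  rw [map_sub, ← ContinuousLinearMap.integral_comp_comm f hμ,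
    ← ContinuousLinearMap.integral_comp_comm f hν]

/-- `(∫ |f(H)|^p)^{1/p} ≤ ‖f‖ (∫ ‖H‖^p)^{1/p}` for a functional `f` and `p > 0` (bookkeeping).
[cite: Buchholz2016, Thm 4.5] -/
theorem rpow_integral_abs_dual_apply_le {X : Type*} [MeasurableSpace X] {μ : Measure X}
    {F : Type*} [NormedAddCommGroup F] [NormedSpace ℝ F]
    (f : StrongDual ℝ F) {H : X → F} {p : ℝ} (hp : 0 < p)
    (hint : Integrable (fun y => ‖H y‖ ^ p) μ) :
    (∫ y, |f (H y)| ^ p ∂μ) ^ (1 / p) ≤ ‖f‖ * (∫ y, ‖H y‖ ^ p ∂μ) ^ (1 / p) := by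
  have hle : ∫ y, |f (H y)| ^ p ∂μ ≤ ∫ y, ‖f‖ ^ p * ‖H y‖ ^ p ∂μ := by
    refine integral_mono_of_nonneg (Filter.Eventually.of_forall fun y => by positivity)
      (hint.const_mul _) (Filter.Eventually.of_forall fun y => ?_)
    simp only []
    rw [← Real.mul_rpow (norm_nonneg _) (norm_nonneg _), ← Real.norm_eq_abs]
    exact Real.rpow_le_rpow (norm_nonneg _) (f.le_opNorm _) hp.le
  have h0 : 0 ≤ ∫ y, |f (H y)| ^ p ∂μ := integral_nonneg fun y => by positivity
  have hI0 : 0 ≤ ∫ y, ‖H y‖ ^ p ∂μ := integral_nonneg fun y => by positivity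
  calc (∫ y, |f (H y)| ^ p ∂μ) ^ (1 / p) ≤ (∫ y, ‖f‖ ^ p * ‖H y‖ ^ p ∂μ) ^ (1 / p) :=
        Real.rpow_le_rpow h0 hle (by positivity)
    _ = (‖f‖ ^ p * ∫ y, ‖H y‖ ^ p ∂μ) ^ (1 / p) := by rw [integral_const_mul]
    _ = ‖f‖ * (∫ y, ‖H y‖ ^ p ∂μ) ^ (1 / p) := by
        rw [Real.mul_rpow (by positivity) hI0, ← Real.rpow_mul (norm_nonneg _),
          mul_one_div_cancel hp.ne', Real.rpow_one]

/-- **Two close non-degenerate centred Gaussians have close expectations of Banach-valued `L^p`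
functionals** ([Buc16] Thm 4.5 / [ABKM19] Thm 6.2, crude core; the form consumed by [ABKM19]
Lemma 8.4 with `ℓ = 1`).  Let `S₀, S₁ ≻ 0` with `|vᵀ(S₀⁻¹ − S₁⁻¹)v| ≤ δ·vᵀS₀⁻¹v`, `p, q` Hölder
conjugate, `0 ≤ δ ≤ 1/(16q)`, `H ∈ L^p(N(0,S₀))` with values in a Banach space and
`N(0,S₁)`-integrable.  Then
`‖∫ H dN(0,S₁) − ∫ H dN(0,S₀)‖ ≤ gaussCompConst |ι| q · δ · (∫ ‖H‖^p dN(0,S₀))^{1/p}`.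
Proof: pair with `f` of norm `≤ 1`, apply the real estimate to `f ∘ H`, and
`‖f ∘ H‖_{L^p} ≤ ‖f‖ ‖H‖_{L^p}`. [cite: Buchholz2016, Thm 4.5] -/
theorem norm_integral_multivariateGaussian_sub_le {S₀ S₁ : Matrix ι ι ℝ} (hS₀ : S₀.PosDef)
    (hS₁ : S₁.PosDef) {δ : ℝ} (hδ0 : 0 ≤ δ)
    (hsand : ∀ v : ι → ℝ, |v ⬝ᵥ (S₀⁻¹ - S₁⁻¹) *ᵥ v| ≤ δ * (v ⬝ᵥ S₀⁻¹ *ᵥ v))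
    {p q : ℝ} (hpq : p.HolderConjugate q) (hδq : δ ≤ 1 / (16 * q))
    {F : Type*} [NormedAddCommGroup F] [NormedSpace ℝ F] [CompleteSpace F]
    {H : EuclideanSpace ℝ ι → F} (hH : MemLp H (ENNReal.ofReal p) (multivariateGaussian 0 S₀))
    (hH₁ : Integrable H (multivariateGaussian 0 S₁)) :
    ‖∫ y, H y ∂(multivariateGaussian 0 S₁) - ∫ y, H y ∂(multivariateGaussian 0 S₀)‖ ≤
      gaussCompConst (Fintype.card ι) q * δ *
        (∫ y, ‖H y‖ ^ p ∂(multivariateGaussian 0 S₀)) ^ (1 / p) := by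
  set μ := multivariateGaussian 0 S₀ with hμ
  have hp1 : 1 < p := hpq.lt
  have hp0 : 0 < p := by linarith
  have hq0 : 0 < q := by linarith [hpq.symm.lt]
  have hpE : ENNReal.ofReal p ≠ 0 := by simp [hp0]
  have hHint : Integrable H μ := hH.integrable (by
    rw [← ENNReal.ofReal_one]; exact ENNReal.ofReal_le_ofReal hp1.le)
  have hnormp : Integrable (fun y => ‖H y‖ ^ p) μ := by
    have h := hH.integrable_norm_rpow hpE ENNReal.ofReal_ne_top
    rw [ENNReal.toReal_ofReal hp0.le] at h
    exact h
  have hK0 : 0 ≤ gaussCompConst (Fintype.card ι) q * δ * (∫ y, ‖H y‖ ^ p ∂μ) ^ (1 / p) :=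
    mul_nonneg (mul_nonneg (gaussCompConst_nonneg _ hq0.le) hδ0)
      (Real.rpow_nonneg (integral_nonneg fun y => by positivity) _)
  refine NormedSpace.norm_le_dual_bound ℝ _ hK0 fun f => ?_
  rw [dual_apply_integral_sub f hH₁ hHint]
  -- the real estimate for `f ∘ H`
  have hfH : MemLp (fun y => f (H y)) (ENNReal.ofReal p) μ :=
    ContinuousLinearMap.comp_memLp' f hH
  have hreal := abs_integral_multivariateGaussian_sub_le hS₀ hS₁ hδ0 hsand hpq hδq hfH
  rw [Real.norm_eq_abs]
  refine hreal.trans ?_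
  have hroot := rpow_integral_abs_dual_apply_le (μ := μ) f hp0 hnormp
  calc gaussCompConst (Fintype.card ι) q * δ * (∫ y, |f (H y)| ^ p ∂μ) ^ (1 / p)
      ≤ gaussCompConst (Fintype.card ι) q * δ * (‖f‖ * (∫ y, ‖H y‖ ^ p ∂μ) ^ (1 / p)) :=
        mul_le_mul_of_nonneg_left hroot (mul_nonneg (gaussCompConst_nonneg _ hq0.le) hδ0)
    _ = gaussCompConst (Fintype.card ι) q * δ * (∫ y, ‖H y‖ ^ p ∂μ) ^ (1 / p) * ‖f‖ := by ring

end Literature.MathematicalPhysics.QuantumFieldTheory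

end
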